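import Summits.HubbardSuperconductivity.HubbardSuperconductivity.Theorems.WeakCouplingBCSKlLindhardEnclosureFloorPiece

/-!
# KL-MARGIN-SCAN reader (22) «kernel-lindhard-enclosure» — boundary FLOOR rule: the kernel's integer pieces against the real log floors

Continuation of `…FloorPiece` for the oriented boundary-floor rule `FloorBdrySoundOrd`: the real per-piece log floor `Params.pieceLoR`
(occupied / empty crescent, `0` when the clamped `b`-range is empty); the kernel's integer piece `Params.bdryPieceLo` (everything rounded
DOWN, `logLoZ Z ≤ 2^40 log (1 + Z/2^40)` from `…LogBounds`) is at most `(α1 − α0) · pieceLoR` (`Params.bdryPieceLo_le`); and for every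
abscissa `u` of a piece with `sPos` endpoints the real floor is below the `b`-integral of the minorant `fminR` over the inner `b`-box
(`Params.pieceLoR_le_integral`, from `inner_integral_ge_occ/_emp`, the `sUpZ`/`bStarUpZ`/`bStarDnZ` records and the antitone `b⋆`).
Honest framing: elementary analysis over the landed kernel; nothing in this file asserts a KL margin at any `t′ ≠ 0`, `K₃`, `U₀`, the window
or B1g dominance; a Kohn–Luttinger instability statement is not ODLRO and nothing here proves superconductivity in the Hubbard model.
(p1 g26, 2026-08-29.)
-/

noncomputable section

set_option linter.dupNamespace false

namespace Summit.HubbardSuperconductivity.HubbardSuperconductivity.Theorems.KlLindhardEnclosure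

open Real Set MeasureTheory Literature.MathematicalPhysics.QuantumLattice
open Summit.HubbardSuperconductivity.HubbardSuperconductivity.Theorems
open Summit.HubbardSuperconductivity.HubbardSuperconductivity.Theorems.KlStair (bandR)

/-! ## §1 The kernel's integer piece against the real log floor -/

/-- The real per-piece log floor that the kernel's `bdryPieceLo occ Vhi α0 α1 bIn0 bIn1` under-approximates (per unit of `α1 − α0`):
occupied crescent `S₁⁻¹ log((S₁(β1 − βm) + W)/(S₁(β0 − βm) + W))` with `S₁ = max(sUpZ α0, sUpZ α1)/2^40`, `W = Vhi/2^40`,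
`βm = bStarDnZ α1/2^40`, `β0 = max(bStarUpZ α0, bIn0)/2^40`, `β1 = bIn1/2^40` (and `0` if `β0 ≥ β1`); empty crescent symmetrically. [folklore] -/
def Params.pieceLoR (P : Params) (occ : Bool) (Vhi α0 α1 bIn0 bIn1 : ℤ) : ℝ :=
  if occ then
    (if max (P.bStarUpZ α0) bIn0 < bIn1 then
      (((max (P.sUpZ α0) (P.sUpZ α1) : ℤ) : ℝ) / 2 ^ 40)⁻¹ *
        Real.log ((((max (P.sUpZ α0) (P.sUpZ α1) : ℤ) : ℝ) / 2 ^ 40 * (((bIn1 : ℤ) : ℝ) / 2 ^ 40 - ((P.bStarDnZ α1 : ℤ) : ℝ) / 2 ^ 40) +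
            ((Vhi : ℤ) : ℝ) / 2 ^ 40) /
          (((max (P.sUpZ α0) (P.sUpZ α1) : ℤ) : ℝ) / 2 ^ 40 * (((max (P.bStarUpZ α0) bIn0 : ℤ) : ℝ) / 2 ^ 40 -
            ((P.bStarDnZ α1 : ℤ) : ℝ) / 2 ^ 40) + ((Vhi : ℤ) : ℝ) / 2 ^ 40))
    else 0)
  else
    (if bIn0 < min (P.bStarDnZ α1) bIn1 then
      (((max (P.sUpZ α0) (P.sUpZ α1) : ℤ) : ℝ) / 2 ^ 40)⁻¹ *
        Real.log ((((max (P.sUpZ α0) (P.sUpZ α1) : ℤ) : ℝ) / 2 ^ 40 * (((P.bStarUpZ α0 : ℤ) : ℝ) / 2 ^ 40 - ((bIn0 : ℤ) : ℝ) / 2 ^ 40) +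
            ((Vhi : ℤ) : ℝ) / 2 ^ 40) /
          (((max (P.sUpZ α0) (P.sUpZ α1) : ℤ) : ℝ) / 2 ^ 40 * (((P.bStarUpZ α0 : ℤ) : ℝ) / 2 ^ 40 -
            ((min (P.bStarDnZ α1) bIn1 : ℤ) : ℝ) / 2 ^ 40) + ((Vhi : ℤ) : ℝ) / 2 ^ 40))
    else 0)

/-- `fdivZ` of a non-negative numerator by a positive denominator is non-negative. -/
theorem fdivZ_nonneg {x y : ℤ} (hx : 0 ≤ x) (hy : 0 < y) : 0 ≤ fdivZ x y := by
  unfold fdivZ; exact Int.ediv_nonneg hx hy.le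

/-- The log-rounding chain of one piece: for `0 < S₁`, `0 ≤ w`, `0 < den`, `0 ≤ num`,
`fdivZ (w · logLoZ (fdivZ (num·D) den)) S₁ ≤ w · (S₁/2^40)⁻¹ · log (1 + num/den)`. -/
theorem floor_piece_rounding {w S1 num den : ℤ} (hw : 0 ≤ w) (hS1 : 0 < S1) (hnum : 0 ≤ num) (hden : 0 < den) :
    ((fdivZ (w * logLoZ (fdivZ (num * D) den)) S1 : ℤ) : ℝ) ≤
      (w : ℝ) * (((((S1 : ℤ) : ℝ) / 2 ^ 40)⁻¹) * Real.log (1 + (num : ℝ) / (den : ℝ))) := by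
  set Z := fdivZ (num * D) den with hZ
  have hZ0 : 0 ≤ Z := fdivZ_nonneg (mul_nonneg hnum (by norm_num [D])) hden
  have hS1' : (0 : ℝ) < (S1 : ℝ) := by exact_mod_cast hS1
  have hden' : (0 : ℝ) < (den : ℝ) := by exact_mod_cast hden
  have hw' : (0 : ℝ) ≤ (w : ℝ) := by exact_mod_cast hw
  have h1 := fdivZ_le_div_real (w * logLoZ Z) S1 hS1
  have h2 := logLoZ_le hZ0
  have h3 : (Z : ℝ) ≤ (num : ℝ) * 2 ^ 40 / (den : ℝ) := by
    have := fdivZ_le_div_real (num * D) den hden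
    rw [Int.cast_mul, cast_D_real] at this
    exact this
  have hZ0' : (0 : ℝ) ≤ (Z : ℝ) := by exact_mod_cast hZ0
  have h4 : Real.log (1 + (Z : ℝ) / 2 ^ 40) ≤ Real.log (1 + (num : ℝ) / (den : ℝ)) := by
    apply Real.log_le_log (by positivity)
    have : (Z : ℝ) / 2 ^ 40 ≤ (num : ℝ) / (den : ℝ) := by
      rw [div_le_iff₀ (by positivity)]
      calc (Z : ℝ) ≤ (num : ℝ) * 2 ^ 40 / (den : ℝ) := h3
        _ = (num : ℝ) / (den : ℝ) * 2 ^ 40 := by ring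
    linarith
  rw [Int.cast_mul] at h1
  calc ((fdivZ (w * logLoZ Z) S1 : ℤ) : ℝ) ≤ (w : ℝ) * ((logLoZ Z : ℤ) : ℝ) / (S1 : ℝ) := h1
    _ ≤ (w : ℝ) * (2 ^ 40 * Real.log (1 + (Z : ℝ) / 2 ^ 40)) / (S1 : ℝ) := by
        apply div_le_div_of_nonneg_right _ hS1'.le
        exact mul_le_mul_of_nonneg_left h2 hw'
    _ ≤ (w : ℝ) * (2 ^ 40 * Real.log (1 + (num : ℝ) / (den : ℝ))) / (S1 : ℝ) := by
        apply div_le_div_of_nonneg_right _ hS1'.le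
        exact mul_le_mul_of_nonneg_left (mul_le_mul_of_nonneg_left h4 (by positivity)) hw'
    _ = (w : ℝ) * (((((S1 : ℤ) : ℝ) / 2 ^ 40)⁻¹) * Real.log (1 + (num : ℝ) / (den : ℝ))) := by
        field_simp

/-- **THE KERNEL PIECE IS BELOW THE REAL LOG FLOOR**: with `0 < Vhi`, `α0 ≤ α1`, `0 < max(sUpZ α0, sUpZ α1)` and
`bStarDnZ α1 ≤ bStarUpZ α0`, `bdryPieceLo occ Vhi α0 α1 bIn0 bIn1 ≤ (α1 − α0) · pieceLoR occ Vhi α0 α1 bIn0 bIn1`. -/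
theorem Params.bdryPieceLo_le (P : Params) (occ : Bool) {Vhi α0 α1 bIn0 bIn1 : ℤ} (hV : 0 < Vhi) (hα : α0 ≤ α1)
    (hS1 : 0 < max (P.sUpZ α0) (P.sUpZ α1)) (hβ : P.bStarDnZ α1 ≤ P.bStarUpZ α0) :
    ((P.bdryPieceLo occ Vhi α0 α1 bIn0 bIn1 : ℤ) : ℝ) ≤ ((α1 - α0 : ℤ) : ℝ) * P.pieceLoR occ Vhi α0 α1 bIn0 bIn1 := by
  have hD : (0 : ℤ) < D := by norm_num [D]
  have hw : 0 ≤ α1 - α0 := by linarith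
  set S1 := max (P.sUpZ α0) (P.sUpZ α1) with hS1def
  have hS1' : (0 : ℝ) < (S1 : ℝ) := by exact_mod_cast hS1
  have hV' : (0 : ℝ) < (Vhi : ℝ) := by exact_mod_cast hV
  cases occ with
  | true =>
    by_cases hif : max (P.bStarUpZ α0) bIn0 < bIn1
    · set b0 := max (P.bStarUpZ α0) bIn0 with hb0
      have hb0β : P.bStarDnZ α1 ≤ b0 := hβ.trans (le_max_left _ _)
      have hden : 0 < Vhi * D + S1 * (b0 - P.bStarDnZ α1) := by
        have : 0 ≤ S1 * (b0 - P.bStarDnZ α1) := mul_nonneg hS1.le (by linarith)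
        nlinarith
      have hnum : 0 ≤ S1 * (bIn1 - b0) := mul_nonneg hS1.le (by linarith)
      have key := floor_piece_rounding hw hS1 hnum hden
      simp only [Params.bdryPieceLo, Params.pieceLoR, if_pos hif, ↓reduceIte, ← hS1def, ← hb0]
      refine key.trans (le_of_eq ?_)
      have hden' : (0 : ℝ) < (Vhi : ℝ) * 2 ^ 40 + (S1 : ℝ) * ((b0 : ℝ) - (P.bStarDnZ α1 : ℝ)) := by
        have h' : (0 : ℝ) < ((Vhi * D + S1 * (b0 - P.bStarDnZ α1) : ℤ) : ℝ) := by exact_mod_cast hden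
        push_cast [cast_D_real] at h'
        linarith
      have harg : (1 : ℝ) + (((S1 * (bIn1 - b0) : ℤ) : ℝ)) / (((Vhi * D + S1 * (b0 - P.bStarDnZ α1) : ℤ) : ℝ)) =
          ((S1 : ℝ) / 2 ^ 40 * (((bIn1 : ℤ) : ℝ) / 2 ^ 40 - ((P.bStarDnZ α1 : ℤ) : ℝ) / 2 ^ 40) + (Vhi : ℝ) / 2 ^ 40) /
            ((S1 : ℝ) / 2 ^ 40 * (((b0 : ℤ) : ℝ) / 2 ^ 40 - ((P.bStarDnZ α1 : ℤ) : ℝ) / 2 ^ 40) + (Vhi : ℝ) / 2 ^ 40) := by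
        push_cast [cast_D_real]
        rw [eq_div_iff (by nlinarith), one_add_div hden'.ne', div_mul_eq_mul_div, div_eq_iff hden'.ne']
        ring
      rw [harg]
    · simp only [Params.bdryPieceLo, Params.pieceLoR, if_neg hif, ↓reduceIte, mul_zero, Int.cast_zero, le_refl]
  | false =>
    by_cases hif : bIn0 < min (P.bStarDnZ α1) bIn1
    · set b1 := min (P.bStarDnZ α1) bIn1 with hb1
      have hb1β : b1 ≤ P.bStarUpZ α0 := (min_le_left _ _).trans hβ
      have hden : 0 < Vhi * D + S1 * (P.bStarUpZ α0 - b1) := by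
        have : 0 ≤ S1 * (P.bStarUpZ α0 - b1) := mul_nonneg hS1.le (by linarith)
        nlinarith
      have hnum : 0 ≤ S1 * (b1 - bIn0) := mul_nonneg hS1.le (by linarith)
      have key := floor_piece_rounding hw hS1 hnum hden
      simp only [Params.bdryPieceLo, Params.pieceLoR, if_pos hif, Bool.false_eq_true, ↓reduceIte, ← hS1def, ← hb1]
      refine key.trans (le_of_eq ?_)
      have hden' : (0 : ℝ) < (Vhi : ℝ) * 2 ^ 40 + (S1 : ℝ) * ((P.bStarUpZ α0 : ℝ) - (b1 : ℝ)) := by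
        have h' : (0 : ℝ) < ((Vhi * D + S1 * (P.bStarUpZ α0 - b1) : ℤ) : ℝ) := by exact_mod_cast hden
        push_cast [cast_D_real] at h'
        linarith
      have harg : (1 : ℝ) + (((S1 * (b1 - bIn0) : ℤ) : ℝ)) / (((Vhi * D + S1 * (P.bStarUpZ α0 - b1) : ℤ) : ℝ)) =
          ((S1 : ℝ) / 2 ^ 40 * (((P.bStarUpZ α0 : ℤ) : ℝ) / 2 ^ 40 - ((bIn0 : ℤ) : ℝ) / 2 ^ 40) + (Vhi : ℝ) / 2 ^ 40) /
            ((S1 : ℝ) / 2 ^ 40 * (((P.bStarUpZ α0 : ℤ) : ℝ) / 2 ^ 40 - ((b1 : ℤ) : ℝ) / 2 ^ 40) + (Vhi : ℝ) / 2 ^ 40) := by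
        push_cast [cast_D_real]
        rw [eq_div_iff (by nlinarith), one_add_div hden'.ne', div_mul_eq_mul_div, div_eq_iff hden'.ne']
        ring
      rw [harg]
    · simp only [Params.bdryPieceLo, Params.pieceLoR, if_neg hif, Bool.false_eq_true, ↓reduceIte, mul_zero, Int.cast_zero, le_refl]

/-! ## §2 The real log floor is below the `b`-integral of the minorant -/

/-- `sPos` holds between two `sPos` abscissae (the slope numerator `2·D·tpD + 4·tpN·a` is affine in `a`). -/
theorem Params.sPos_between (P : Params) {lo hi α : ℤ} (hlo : P.sPos lo = true) (hhi : P.sPos hi = true) (h0 : lo ≤ α)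
    (h1 : α ≤ hi) : P.sPos α = true := by
  simp only [Params.sPos, decide_eq_true_eq] at *
  rcases le_or_gt 0 P.tpN with ht | ht
  · nlinarith
  · nlinarith

/-- Casting `max` through `/2^40`. -/
theorem cast_max_div (x y : ℤ) : ((max x y : ℤ) : ℝ) / 2 ^ 40 = max (((x : ℤ) : ℝ) / 2 ^ 40) (((y : ℤ) : ℝ) / 2 ^ 40) := by
  rcases le_total x y with h | h
  · rw [max_eq_right h, max_eq_right (div_le_div_of_nonneg_right (by exact_mod_cast h) (by positivity))]
  · rw [max_eq_left h, max_eq_left (div_le_div_of_nonneg_right (by exact_mod_cast h) (by positivity))]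

/-- Casting `min` through `/2^40`. -/
theorem cast_min_div (x y : ℤ) : ((min x y : ℤ) : ℝ) / 2 ^ 40 = min (((x : ℤ) : ℝ) / 2 ^ 40) (((y : ℤ) : ℝ) / 2 ^ 40) := by
  rcases le_total x y with h | h
  · rw [min_eq_left h, min_eq_left (div_le_div_of_nonneg_right (by exact_mod_cast h) (by positivity))]
  · rw [min_eq_right h, min_eq_right (div_le_div_of_nonneg_right (by exact_mod_cast h) (by positivity))]

/-- **THE REAL LOG FLOOR IS BELOW THE `b`-INTEGRAL OF THE MINORANT** on an abscissa piece `[α0, α1]/2^40` with `sPos` endpoints: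
for `u` in the piece, `pieceLoR occ Vhi α0 α1 bIn0 bIn1 ≤ ∫_{[bIn0,bIn1]/2^40} fminR t′ μ (!occ) (Vhi/2^40) u` (`0 < Vhi`, `t′μ < 1`). -/
theorem Params.pieceLoR_le_integral (P : Params) (htpD : 0 < P.tpD) (hmuD : 0 < P.muD)
    (htμ : (P.tpN : ℝ) / (P.tpD : ℝ) * ((P.muN : ℝ) / (P.muD : ℝ)) < 1) (occ : Bool) {Vhi α0 α1 : ℤ} (bIn0 bIn1 : ℤ)
    (hV : 0 < Vhi) (hs0 : P.sPos α0 = true) (hs1 : P.sPos α1 = true) {u : ℝ}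
    (hu0 : ((α0 : ℤ) : ℝ) / 2 ^ 40 ≤ u) (hu1 : u ≤ ((α1 : ℤ) : ℝ) / 2 ^ 40) :
    P.pieceLoR occ Vhi α0 α1 bIn0 bIn1 ≤
      ∫ v in Icc (((bIn0 : ℤ) : ℝ) / 2 ^ 40) (((bIn1 : ℤ) : ℝ) / 2 ^ 40),
        fminR ((P.tpN : ℝ) / (P.tpD : ℝ)) ((P.muN : ℝ) / (P.muD : ℝ)) (!occ) (((Vhi : ℤ) : ℝ) / 2 ^ 40) u v := by
  set t := (P.tpN : ℝ) / (P.tpD : ℝ) with ht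
  set μ := (P.muN : ℝ) / (P.muD : ℝ) with hμ
  have hW : (0 : ℝ) < ((Vhi : ℤ) : ℝ) / 2 ^ 40 := div_pos (by exact_mod_cast hV) (by positivity)
  have hS0 := P.sPos_real htpD hs0
  have hS1' := P.sPos_real htpD hs1
  have hSu : 0 < slopeS t u := slopeS_pos_between t hS0 hS1' hu0 hu1
  have hSle : slopeS t u ≤ ((max (P.sUpZ α0) (P.sUpZ α1) : ℤ) : ℝ) / 2 ^ 40 := by
    rw [cast_max_div]
    exact (slopeS_between t hu0 hu1).2.trans (max_le_max (P.le_sUpZ htpD α0) (P.le_sUpZ htpD α1))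
  have hbm := P.bStarDnZ_le htpD hmuD hs1
  have hbM := P.le_bStarUpZ htpD hmuD hs0
  have hanti1 : bStar t μ (((α1 : ℤ) : ℝ) / 2 ^ 40) ≤ bStar t μ u := bStar_le_bStar htμ hSu hS1' hu1
  have hanti0 : bStar t μ u ≤ bStar t μ (((α0 : ℤ) : ℝ) / 2 ^ 40) := bStar_le_bStar htμ hS0 hSu hu0
  have hnn : 0 ≤ ∫ v in Icc (((bIn0 : ℤ) : ℝ) / 2 ^ 40) (((bIn1 : ℤ) : ℝ) / 2 ^ 40), fminR t μ (!occ) (((Vhi : ℤ) : ℝ) / 2 ^ 40) u v :=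
    setIntegral_nonneg measurableSet_Icc fun v _ => fminR_nonneg t μ (!occ) hW u v
  cases occ with
  | true =>
    simp only [Params.pieceLoR, ↓reduceIte, Bool.not_true] at hnn ⊢
    by_cases hif : max (P.bStarUpZ α0) bIn0 < bIn1
    · rw [if_pos hif]
      have hI0 : ((bIn0 : ℤ) : ℝ) / 2 ^ 40 ≤ ((max (P.bStarUpZ α0) bIn0 : ℤ) : ℝ) / 2 ^ 40 :=
        div_le_div_of_nonneg_right (by exact_mod_cast le_max_right _ _) (by positivity)
      have hb0 : bStar t μ u ≤ ((max (P.bStarUpZ α0) bIn0 : ℤ) : ℝ) / 2 ^ 40 :=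
        hanti0.trans (hbM.trans (div_le_div_of_nonneg_right (by exact_mod_cast le_max_left _ _) (by positivity)))
      have h01 : ((max (P.bStarUpZ α0) bIn0 : ℤ) : ℝ) / 2 ^ 40 ≤ ((bIn1 : ℤ) : ℝ) / 2 ^ 40 :=
        div_le_div_of_nonneg_right (by exact_mod_cast hif.le) (by positivity)
      exact inner_integral_ge_occ hSu hSle hW (hbm.trans hanti1) hb0 h01 hI0 le_rfl
    · rw [if_neg hif]; exact hnn
  | false =>
    simp only [Params.pieceLoR, Bool.false_eq_true, ↓reduceIte, Bool.not_false] at hnn ⊢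
    by_cases hif : bIn0 < min (P.bStarDnZ α1) bIn1
    · rw [if_pos hif]
      have hI1 : ((min (P.bStarDnZ α1) bIn1 : ℤ) : ℝ) / 2 ^ 40 ≤ ((bIn1 : ℤ) : ℝ) / 2 ^ 40 :=
        div_le_div_of_nonneg_right (by exact_mod_cast min_le_right _ _) (by positivity)
      have hb1 : ((min (P.bStarDnZ α1) bIn1 : ℤ) : ℝ) / 2 ^ 40 ≤ bStar t μ u :=
        le_trans (div_le_div_of_nonneg_right (by exact_mod_cast min_le_left _ _) (by positivity)) (hbm.trans hanti1)
      have h01 : ((bIn0 : ℤ) : ℝ) / 2 ^ 40 ≤ ((min (P.bStarDnZ α1) bIn1 : ℤ) : ℝ) / 2 ^ 40 :=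
        div_le_div_of_nonneg_right (by exact_mod_cast hif.le) (by positivity)
      exact inner_integral_ge_emp hSu hSle hW (hanti0.trans hbM) hb1 h01 le_rfl hI1
    · rw [if_neg hif]; exact hnn

end Summit.HubbardSuperconductivity.HubbardSuperconductivity.Theorems.KlLindhardEnclosure

end
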